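import Literature.Probability.LatticeModels.IsingConsistency
import Literature.Probability.LatticeModels.GibbsSpecificationProofs
import HarnessLib

/-!
# The free finite-volume Ising measure satisfies the DLR equations in its interior

Topic `Literature/Probability/LatticeModels`. Theorem-only companion of `IsingConsistency.lean`
(which treats a *fixed* outer boundary condition): for the free-boundary measure
`μ^∅_{Λ;β,h}` of `IsingModel.lean` and a sub-volume `Λ' ⊆ Λ` whose outer vertex boundary lies in
`Λ` (every edge touching `Λ'` is an edge of `Λ`), conditioning on the spins off `Λ'` gives the
Ising kernel `μ^{·}_{Λ';β,h}` of the whole graph: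

`∫ μ^σ_{Λ';β,h}(A) dμ^∅_{Λ;β,h}(σ) = μ^∅_{Λ;β,h}(A)`  (`lintegral_isingMeasure_fixed_free`).

This is the finite-volume input of the classical fact that thermodynamic limits of free-boundary
finite-volume measures are infinite-volume Gibbs measures (Friedli–Velenik 2017, Thm. 6.26 with
Exercise 3.16 / Lemma 6.7: the spatial Markov property (3.26) of the finite-volume measures; for
the free boundary condition the Hamiltonian `ℋ^∅_Λ` of eq. (3.2) involves only the edges of `ℰ_Λ`,
so the property holds for the sub-volumes `Δ` with `∂ᵉˣΔ ⊆ Λ`). The proofs are the Boltzmann-sum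
manipulations of `IsingConsistency.lean` with the edge set `ℰ_Λ` (`edgesIn`) in place of
`ℰ^b_Λ` (`edgesTouching`):

* `glue_free_eq_glue_glue`, `isingWeight_free_eq_mul`, `sum_isingWeight_free_eq_sum_sum` — the
  two-step decomposition: summing first over the spins of `Λ ∖ Λ'` (which become the boundary
  condition of `Λ'`, the spins off `Λ` being the free junk value `1`, invisible from `Λ'` since
  `∂ᵉˣΛ' ⊆ Λ`), then over the spins of `Λ'` with the **fixed** kernel;
* `lintegral_isingMeasure_fixed_free` — the DLR identity above.

## Mathlib status

No Ising model in Mathlib. Anchors: `Equiv.sum_comp`, `Fintype.sum_prod_type_right`,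
`MeasureTheory.lintegral` of the tree's Boltzmann sums (`lintegral_isingMeasure`).
-/

noncomputable section

open MeasureTheory Finset
open scoped ENNReal

namespace Literature.Probability.LatticeModels

variable {V : Type*} (G : SimpleGraph V) [DecidableEq V] [G.LocallyFinite]

omit [G.LocallyFinite] in
/-- **Gluing in two steps, free outer boundary condition.** For `Λ' ⊆ Λ`, gluing `τ : Λ → ℤˣ`
with the free boundary condition is gluing its restriction to `Λ'` into the configuration
obtained by gluing its restriction to `Λ ∖ Λ'` with the free boundary condition (the
decomposition `ω = ω_Δ ω_{Λ∖Δ}` of Friedli–Velenik 2017, proof of Lemma 6.7, free case).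
[cite: FriedliVelenik2017, §3.1 and Lemma 6.7] -/
theorem glue_free_eq_glue_glue [G.LocallyFinite] {Λ' Λ : Finset V} (hsub : Λ' ⊆ Λ) (τ : Λ → ℤˣ) :
    glue Λ τ .free =
      glue Λ' (fun x => τ ⟨x, hsub x.2⟩)
        (.fixed (glue (Λ \ Λ') (fun x => τ ⟨x, (Finset.mem_sdiff.1 x.2).1⟩) .free)) := by
  funext x
  by_cases hx' : x ∈ Λ'
  · rw [glue_apply_of_mem _ _ _ (hsub hx'), glue_apply_of_mem _ _ _ hx']
  · rw [glue_apply_of_notMem _ _ _ hx', BoundaryCondition.outside_fixed]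
    by_cases hx : x ∈ Λ
    · rw [glue_apply_of_mem _ _ _ hx, glue_apply_of_mem _ _ _ (Finset.mem_sdiff.2 ⟨hx, hx'⟩)]
    · rw [glue_apply_of_notMem _ _ _ hx, glue_apply_of_notMem _ _ _
        (fun h => hx (Finset.mem_sdiff.1 h).1)]

/-- If the outer vertex boundary of `Λ'` lies in `Λ ⊇ Λ'`, every edge touching `Λ'` is an edge of
`Λ`: `ℰ^b_{Λ'} ⊆ ℰ_Λ`. [cite: FriedliVelenik2017, §3.1, eqs. (3.2) and (3.6)] -/
theorem edgesTouching_subset_edgesIn {Λ' Λ : Finset V} (hsub : Λ' ⊆ Λ)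
    (hbd : ∀ x ∈ Λ', ∀ y, G.Adj x y → y ∈ Λ) : edgesTouching G Λ' ⊆ edgesIn G Λ := by
  intro e he
  rw [mem_edgesTouching_iff] at he
  obtain ⟨he, x, hx, hxe⟩ := he
  rw [mem_edgesIn_iff]
  refine ⟨he, fun z hz => ?_⟩
  by_cases hzx : z = x
  · exact hzx ▸ hsub hx
  · have : e = s(x, z) := (Sym2.mem_and_mem_iff (Ne.symm hzx)).1 ⟨hxe, hz⟩
    subst this
    exact hbd x hx z ((SimpleGraph.mem_edgeSet G).1 he)

/-- **The free Boltzmann weight in two steps.** For `Λ' ⊆ Λ` with `ℰ^b_{Λ'} ⊆ ℰ_Λ`,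
`w^∅_{Λ;β,h}(τ) = exp (β (∑_{e ∈ ℰ_Λ ∖ ℰ^b_{Λ'}} σ_e(τ₂∨1) + h ∑_{x ∈ Λ∖Λ'} (τ₂)_x)) · w^{τ₂∨1}_{Λ';β,h}(τ₁)`,
where `τ₁, τ₂` are the restrictions of `τ` to `Λ'`, `Λ ∖ Λ'` and `τ₂ ∨ 1` is `τ₂` glued with the free
boundary condition: the free Hamiltonian `ℋ^∅_Λ` (edges `ℰ_Λ`) is the fixed Hamiltonian
`ℋ^{τ₂∨1}_{Λ'}` (edges `ℰ^b_{Λ'}`) plus a term not involving the spins of `Λ'`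
(Friedli–Velenik 2017, Lemma 6.7, eq. (6.10), free case; eqs. (3.1)–(3.2)).
[cite: FriedliVelenik2017, Lemma 6.7, eq. (6.10)] -/
theorem isingWeight_free_eq_mul {Λ' Λ : Finset V} (hsub : Λ' ⊆ Λ)
    (hE : edgesTouching G Λ' ⊆ edgesIn G Λ) (β h : ℝ) (τ : Λ → ℤˣ) :
    isingWeight G Λ β h .free τ =
      Real.exp (β * (∑ e ∈ edgesIn G Λ \ edgesTouching G Λ',
          bondSpin (glue (Λ \ Λ') (fun x => τ ⟨x, (Finset.mem_sdiff.1 x.2).1⟩) .free) e +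
        h * ∑ x ∈ Λ \ Λ',
          spinAt x (glue (Λ \ Λ') (fun x => τ ⟨x, (Finset.mem_sdiff.1 x.2).1⟩) .free))) *
      isingWeight G Λ' β h
        (.fixed (glue (Λ \ Λ') (fun x => τ ⟨x, (Finset.mem_sdiff.1 x.2).1⟩) .free))
        (fun x => τ ⟨x, hsub x.2⟩) := by
  set η₂ := glue (Λ \ Λ') (fun x => τ ⟨x, (Finset.mem_sdiff.1 x.2).1⟩) .free with hη₂
  set τ₁ : Λ' → ℤˣ := fun x => τ ⟨x, hsub x.2⟩ with hτ₁
  have hcfg : glue Λ τ .free = glue Λ' τ₁ (.fixed η₂) := glue_free_eq_glue_glue G hsub τ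
  rw [isingWeight, isingWeight, ← Real.exp_add, hcfg]
  congr 1
  set σ := glue Λ' τ₁ (.fixed η₂) with hσ
  -- outside `Λ'` the glued configuration is `η₂`
  have hout : ∀ x, x ∉ Λ' → σ x = η₂ x := fun x hx => by
    rw [hσ, glue_apply_of_notMem _ _ _ hx, BoundaryCondition.outside_fixed]
  have hbond : ∀ e ∈ edgesIn G Λ \ edgesTouching G Λ', bondSpin σ e = bondSpin η₂ e := by
    intro e he
    obtain ⟨heΛ, heΛ'⟩ := Finset.mem_sdiff.1 he
    have hends : ∀ z ∈ e, z ∉ Λ' := fun z hz hzΛ' =>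
      heΛ' (mem_edgesTouching_iff.2 ⟨(mem_edgesIn_iff.1 heΛ).1, z, hzΛ', hz⟩)
    induction e using Sym2.ind with
    | _ a b =>
      simp only [bondSpin_mk, spinAt, hout a (hends a (Sym2.mem_mk_left _ _)),
        hout b (hends b (Sym2.mem_mk_right _ _))]
  have hfield : ∀ x ∈ Λ \ Λ', spinAt x σ = spinAt x η₂ := fun x hx => by
    simp only [spinAt, hout x (Finset.mem_sdiff.1 hx).2]
  have hE' : ∑ e ∈ edgesIn G Λ, bondSpin σ e =
      ∑ e ∈ edgesTouching G Λ', bondSpin σ e +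
        ∑ e ∈ edgesIn G Λ \ edgesTouching G Λ', bondSpin η₂ e := by
    rw [← Finset.sum_sdiff hE, add_comm, Finset.sum_congr rfl hbond]
  have hF : ∑ x ∈ Λ, spinAt x σ = ∑ x ∈ Λ', spinAt x σ + ∑ x ∈ Λ \ Λ', spinAt x η₂ := by
    rw [← Finset.sum_sdiff hsub, add_comm, Finset.sum_congr rfl hfield]
  simp only [isingHamiltonian, interactionEdges_fixed, interactionEdges_free, hE', hF]
  ring

/-- **The free Boltzmann sum in two steps** (spatial Markov property of the free measure,
Friedli–Velenik 2017, Lemma 6.7, eq. (6.5) / Exercise 3.11, eq. (3.26), free case): for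
`Λ' ⊆ Λ` with `ℰ^b_{Λ'} ⊆ ℰ_Λ` and any `F`,
`∑_τ w^∅_Λ(τ) F(τ ∨ 1) = ∑_{τ₂} e^{β(…)} ∑_{τ₁} w^{τ₂∨1}_{Λ'}(τ₁) F(τ₁ ∨ (τ₂ ∨ 1))`, summing
first over the spins `τ₂` of `Λ ∖ Λ'` (the boundary condition seen from `Λ'`) and then over the
spins `τ₁` of `Λ'` with the fixed-boundary weights. [cite: FriedliVelenik2017, Lemma 6.7, eq. (6.5)] -/
theorem sum_isingWeight_free_eq_sum_sum {Λ' Λ : Finset V} (hsub : Λ' ⊆ Λ)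
    (hE : edgesTouching G Λ' ⊆ edgesIn G Λ) (β h : ℝ) (F : SpinConfig V → ℝ) :
    ∑ τ : Λ → ℤˣ, isingWeight G Λ β h .free τ * F (glue Λ τ .free) =
      ∑ τ₂ : ↥(Λ \ Λ') → ℤˣ,
        Real.exp (β * (∑ e ∈ edgesIn G Λ \ edgesTouching G Λ',
            bondSpin (glue (Λ \ Λ') τ₂ .free) e +
          h * ∑ x ∈ Λ \ Λ', spinAt x (glue (Λ \ Λ') τ₂ .free))) *
        ∑ τ₁ : Λ' → ℤˣ, isingWeight G Λ' β h (.fixed (glue (Λ \ Λ') τ₂ .free)) τ₁ *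
          F (glue Λ' τ₁ (.fixed (glue (Λ \ Λ') τ₂ .free))) := by
  classical
  -- restriction maps and the splitting equivalence
  let r₁ : (Λ → ℤˣ) → (Λ' → ℤˣ) := fun τ x => τ ⟨x, hsub x.2⟩
  let r₂ : (Λ → ℤˣ) → (↥(Λ \ Λ') → ℤˣ) := fun τ x => τ ⟨x, (Finset.mem_sdiff.1 x.2).1⟩
  let eqv : (Λ → ℤˣ) ≃ (Λ' → ℤˣ) × (↥(Λ \ Λ') → ℤˣ) :=
    { toFun := fun τ => (r₁ τ, r₂ τ)
      invFun := fun p x => if hx : (x : V) ∈ Λ' then p.1 ⟨x, hx⟩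
        else p.2 ⟨x, Finset.mem_sdiff.2 ⟨x.2, hx⟩⟩
      left_inv := fun τ => by
        funext x
        by_cases hx : (x : V) ∈ Λ' <;> simp [r₁, r₂, hx]
      right_inv := fun p => by
        ext x
        · simp [r₁, x.2]
        · have hx : (x : V) ∉ Λ' := (Finset.mem_sdiff.1 x.2).2
          simp [r₂, hx] }
  rw [← Equiv.sum_comp eqv.symm, Fintype.sum_prod_type_right]
  refine Finset.sum_congr rfl fun τ₂ _ => ?_
  rw [Finset.mul_sum]
  refine Finset.sum_congr rfl fun τ₁ _ => ?_
  have h1 : r₁ (eqv.symm (τ₁, τ₂)) = τ₁ := congrArg Prod.fst (eqv.apply_symm_apply (τ₁, τ₂))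
  have h2 : r₂ (eqv.symm (τ₁, τ₂)) = τ₂ := congrArg Prod.snd (eqv.apply_symm_apply (τ₁, τ₂))
  have hw := isingWeight_free_eq_mul G hsub hE β h (eqv.symm (τ₁, τ₂))
  have hc := glue_free_eq_glue_glue G hsub (eqv.symm (τ₁, τ₂))
  change isingWeight G Λ β h .free (eqv.symm (τ₁, τ₂)) =
    Real.exp (β * (∑ e ∈ edgesIn G Λ \ edgesTouching G Λ',
        bondSpin (glue (Λ \ Λ') (r₂ (eqv.symm (τ₁, τ₂))) .free) e +
      h * ∑ x ∈ Λ \ Λ', spinAt x (glue (Λ \ Λ') (r₂ (eqv.symm (τ₁, τ₂))) .free))) *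
    isingWeight G Λ' β h (.fixed (glue (Λ \ Λ') (r₂ (eqv.symm (τ₁, τ₂))) .free))
      (r₁ (eqv.symm (τ₁, τ₂))) at hw
  change glue Λ (eqv.symm (τ₁, τ₂)) .free =
    glue Λ' (r₁ (eqv.symm (τ₁, τ₂))) (.fixed (glue (Λ \ Λ') (r₂ (eqv.symm (τ₁, τ₂))) .free)) at hc
  rw [h1, h2] at hw hc
  rw [hw, hc]
  ring

/-- **The free measure satisfies the DLR equation in its interior** (Friedli–Velenik 2017,
Lemma 6.7 (compatibility) for the free Hamiltonian (3.2), i.e. the spatial Markov property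
(3.26) of `μ^∅_{Λ;β,h}`; this is the finite-volume step of Thm. 6.26 / Exercise 3.16 showing that
the thermodynamic limit `⟨·⟩^∅` is a Gibbs state). For `Λ' ⊆ Λ` such that every neighbour of a
vertex of `Λ'` lies in `Λ` (`∂ᵉˣΛ' ⊆ Λ`) and measurable `A`,
`∫ μ^σ_{Λ';β,h}(A) dμ^∅_{Λ;β,h}(σ) = μ^∅_{Λ;β,h}(A)`: both sides are free Boltzmann sums over the
configurations of `Λ`; by the two-step decomposition (`sum_isingWeight_free_eq_sum_sum`) applied
to `1_A` and to `ζ ↦ μ^ζ_{Λ'}(A)` — which depends on `ζ` only off `Λ'` — the inner sums over the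
spins of `Λ'` agree term by term. No sign condition on `β`, `h`. [cite: FriedliVelenik2017, Lemma 6.7 with eq. (3.2) and Exercise 3.16] -/
theorem lintegral_isingMeasure_fixed_free {Λ' Λ : Finset V} (hsub : Λ' ⊆ Λ)
    (hbd : ∀ x ∈ Λ', ∀ y, G.Adj x y → y ∈ Λ) (β h : ℝ)
    {A : Set (SpinConfig V)} (hA : MeasurableSet A) :
    ∫⁻ σ, isingMeasure G Λ' β h (.fixed σ) A ∂(isingMeasure G Λ β h .free) =
      isingMeasure G Λ β h .free A := by
  classical
  have hE : edgesTouching G Λ' ⊆ edgesIn G Λ := edgesTouching_subset_edgesIn G hsub hbd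
  have hZpos : 0 < isingPartitionFunction G Λ β h .free := isingPartitionFunction_pos G Λ β h _
  -- `q ζ = μ^ζ_{Λ'}(A)` as a real number: `S_A(ζ) / Z_{Λ'}(ζ)`
  set S : SpinConfig V → ℝ := fun ζ =>
    ∑ τ : Λ' → ℤˣ, if glue Λ' τ (.fixed ζ) ∈ A then isingWeight G Λ' β h (.fixed ζ) τ else 0
    with hS
  set q : SpinConfig V → ℝ := fun ζ => S ζ / isingPartitionFunction G Λ' β h (.fixed ζ) with hq
  have hq_nonneg : ∀ ζ, 0 ≤ q ζ := fun ζ =>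
    div_nonneg (Finset.sum_nonneg fun τ _ => by
      split_ifs
      · exact (isingWeight_pos G Λ' β h _ τ).le
      · exact le_rfl) (isingPartitionFunction_pos G Λ' β h _).le
  have hμΛ : ∀ ζ, isingMeasure G Λ' β h (.fixed ζ) A = ENNReal.ofReal (q ζ) := fun ζ => by
    rw [isingMeasure_apply_of_measurableSet G Λ' β h (.fixed ζ) hA, Finset.sum_filter]
  -- `q` depends on `ζ` only off `Λ'`
  have hq_congr : ∀ ζ ζ' : SpinConfig V, (∀ x ∉ Λ', ζ x = ζ' x) → q ζ = q ζ' := by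
    intro ζ ζ' hζ
    have h1 := isingMeasure_fixed_congr_of_eqOn_compl G Λ' β h hζ hA
    rw [hμΛ, hμΛ] at h1
    exact (ENNReal.ofReal_eq_ofReal_iff (hq_nonneg ζ) (hq_nonneg ζ')).1 h1
  -- `Z_{Λ'}(ζ) q(ζ) = S(ζ)`
  have hZq : ∀ ζ, (∑ τ : Λ' → ℤˣ, isingWeight G Λ' β h (.fixed ζ) τ) * q ζ = S ζ := fun ζ => by
    rw [hq]
    exact mul_div_cancel₀ _ (isingPartitionFunction_pos G Λ' β h (.fixed ζ)).ne'
  -- left-hand side as a free Boltzmann sum over `Λ`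
  have hLHS : ∫⁻ σ, isingMeasure G Λ' β h (.fixed σ) A ∂(isingMeasure G Λ β h .free) =
      ENNReal.ofReal ((∑ τ : Λ → ℤˣ, isingWeight G Λ β h .free τ *
        q (glue Λ τ .free)) / isingPartitionFunction G Λ β h .free) := by
    have hmeas : Measurable fun σ : SpinConfig V => isingMeasure G Λ' β h (.fixed σ) A :=
      (measurable_isingMeasure_fixed G Λ' β h hA).mono cylinderEvents_le_pi le_rfl
    rw [lintegral_isingMeasure G Λ β h .free hmeas, Finset.sum_div,
      ENNReal.ofReal_sum_of_nonneg (fun τ _ => div_nonneg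
        (mul_nonneg (isingWeight_pos G Λ β h _ τ).le (hq_nonneg _)) hZpos.le)]
    refine Finset.sum_congr rfl fun τ _ => ?_
    rw [hμΛ, ← ENNReal.ofReal_mul (div_nonneg (isingWeight_pos G Λ β h _ τ).le hZpos.le)]
    congr 1
    ring
  -- right-hand side as a free Boltzmann sum over `Λ`
  have hRHS : isingMeasure G Λ β h .free A =
      ENNReal.ofReal ((∑ τ : Λ → ℤˣ, isingWeight G Λ β h .free τ *
        (if glue Λ τ .free ∈ A then (1 : ℝ) else 0)) /
          isingPartitionFunction G Λ β h .free) := by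
    rw [isingMeasure_apply_of_measurableSet G Λ β h .free hA, Finset.sum_filter]
    congr 3
    funext τ
    split_ifs <;> simp
  rw [hLHS, hRHS]
  congr 2
  -- the two-step decomposition, applied to `q` and to `1_A`
  rw [sum_isingWeight_free_eq_sum_sum G hsub hE β h q,
    sum_isingWeight_free_eq_sum_sum G hsub hE β h (fun σ => if σ ∈ A then (1 : ℝ) else 0)]
  refine Finset.sum_congr rfl fun τ₂ _ => ?_
  congr 1
  set η₂ : SpinConfig V := glue (Λ \ Λ') τ₂ .free with hη₂
  -- inner sums: `∑_{τ₁} w^{η₂}_{Λ'}(τ₁) q(τ₁ ∨ η₂) = Z_{Λ'}(η₂) q(η₂) = S(η₂) = ∑_{τ₁} w 1_A`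
  have hinner : ∀ τ₁ : Λ' → ℤˣ, q (glue Λ' τ₁ (.fixed η₂)) = q η₂ := fun τ₁ =>
    hq_congr _ _ fun x hx => by
      rw [glue_apply_of_notMem _ _ _ hx, BoundaryCondition.outside_fixed]
  calc ∑ τ₁ : Λ' → ℤˣ, isingWeight G Λ' β h (.fixed η₂) τ₁ * q (glue Λ' τ₁ (.fixed η₂))
      = (∑ τ₁ : Λ' → ℤˣ, isingWeight G Λ' β h (.fixed η₂) τ₁) * q η₂ := by
        rw [Finset.sum_mul]
        exact Finset.sum_congr rfl fun τ₁ _ => by rw [hinner τ₁]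
    _ = S η₂ := hZq η₂
    _ = ∑ τ₁ : Λ' → ℤˣ, isingWeight G Λ' β h (.fixed η₂) τ₁ *
          (if glue Λ' τ₁ (.fixed η₂) ∈ A then (1 : ℝ) else 0) := by
        rw [hS]
        refine Finset.sum_congr rfl fun τ₁ _ => ?_
        split_ifs <;> simp

end Literature.Probability.LatticeModels

end
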